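import Literature.AlgebraicGeometry.Frobenioids.ArchimedeanPseudoTerminal
import Literature.AlgebraicGeometry.Frobenioids.ArchimedeanTheoremsInstances
import HarnessLib

/-!
# Frobenioids II, Theorem 3.6 (vi) (pseudo-terminal objects): the instance statement `Thm36vi_CA` of
# `ArchimedeanTheoremsInstances.lean` — PROOF-ONLY companion

Mochizuki, *The geometry of Frobenioids II*, Kyushu J. Math. **62** (2008) 401–460, §3, Theorem 3.6 (vi),
author's kurims text p. 37 [cite: MochizukiFrdII2008, Thm 3.6 (vi) p.37]: "If `D` admits a pseudo-terminal
object, then `F` admits a pseudo-terminal object" for `F ∈ {C^Λ, A}` (DAG node `FrdII:Thm3.6(vi)`).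

The instance statement is `ArchFrd.Thm36vi_CA π pf rlf := (∀ Λ, Thm36vi D (C^Λ)) ∧ Thm36vi D A`, where
`C^ℤ = C π` and `C^ℚ := pf`, `C^ℝ := rlf` are the UNINTERPRETED completion data
(`ArchFrd.LambdaCompletion`, interface of `AngularFrobenioidsRelative.lean`: an arbitrary category with a
pre-Frobenioid structure and a functor from `C`; [FrdI] Def. 3.1 (iii) perfection / Prop. 5.3 realification
are not yet bound to it). What is proved here, consuming the landed proofs of seat abc-iut-L1-t9
(`ArchimedeanPseudoTerminal.lean`: `thm36vi_C`, `thm36vi_A`, PROVED over any base `π : D → D₀`) BY NAME: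
* `thm36vi_CA_Z` — the `Λ = ℤ` conjunct (`archFrobenioid_Z`: `C^ℤ = C`, definitionally);
* the `A` conjunct IS t9's landed `thm36vi_A` (not restated);
* `thm36vi_CA_iff` — the instance statement is EQUIVALENT to its two `Λ ∈ {ℚ, ℝ}` conjuncts
  `Thm36vi D pf.cat ∧ Thm36vi D rlf.cat`; `thm36vi_CA_of` — hence it holds as soon as those are supplied.
FINDING T36vi-F1 (statement-level, LOW; the (vi)-twin of T36ix-F1/T36x-F1 of
`ArchimedeanDissectionProofs.lean` / `ArchimedeanSlimInstances.lean`): the two residual conjuncts speak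
about arbitrary interface data and are NOT dischargeable as typed (a junk `pf` whose category has no
pseudo-terminal object over a base that has one refutes `Thm36vi D pf.cat`); they become provable once
`pf`/`rlf` are the constructed completions. HONEST FRAMING: nothing here bears on [IUTchIII] Cor. 3.12;
typed ≠ proved except where a `theorem` says so.
-/

namespace Literature.AlgebraicGeometry.Frobenioids

open CategoryTheory

noncomputable section

universe v u

namespace ArchFrd

variable {D : Type u} [Category.{v} D] (π : D ⥤ D0) (pf rlf : LambdaCompletion π)

/-- **Theorem 3.6 (vi) at `C^ℤ = C`** (the `Λ = ℤ` conjunct of `Thm36vi_CA`; `archFrobenioid_Z`): from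
`thm36vi_C`. [cite: MochizukiFrdII2008, Thm 3.6 (vi) p.37] -/
theorem thm36vi_CA_Z : Thm36vi D (archFrobenioid π pf rlf MonoidType.Z).cat :=
  thm36vi_C π

/-- **The instance statement `Thm36vi_CA π pf rlf` reduces to EXACTLY its two `Λ ∈ {ℚ, ℝ}` conjuncts**
(the `Λ = ℤ` and `A` parts being proved); those concern the categories `pf.cat`, `rlf.cat` of the
uninterpreted completion data and are not dischargeable as typed (finding T36vi-F1).
[cite: MochizukiFrdII2008, Thm 3.6 (vi) p.37] -/
theorem thm36vi_CA_iff :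
    Literature.AlgebraicGeometry.Frobenioids.ArchFrd.Thm36vi_CA π pf rlf ↔
      Thm36vi D pf.cat ∧ Thm36vi D rlf.cat := by
  constructor
  · intro h
    exact ⟨h.1 MonoidType.Q, h.1 MonoidType.R⟩
  · rintro ⟨hQ, hR⟩
    refine ⟨fun Λ => ?_, thm36vi_A π⟩
    cases Λ with
    | Z => exact thm36vi_C π
    | Q => exact hQ
    | R => exact hR

/-- `Thm36vi_CA` from its two interface conjuncts (`C^ℚ := pf`, `C^ℝ := rlf` admitting pseudo-terminal
objects whenever `D` does). [cite: MochizukiFrdII2008, Thm 3.6 (vi) p.37] -/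
theorem thm36vi_CA_of (hQ : Thm36vi D pf.cat) (hR : Thm36vi D rlf.cat) :
    Literature.AlgebraicGeometry.Frobenioids.ArchFrd.Thm36vi_CA π pf rlf :=
  (thm36vi_CA_iff π pf rlf).2 ⟨hQ, hR⟩

/-- In particular, for the trivial completion data `pf = rlf = C` (all three `C^Λ` read as `C` itself) the
instance statement holds outright. [cite: MochizukiFrdII2008, Thm 3.6 (vi) p.37] -/
theorem thm36vi_CA_self :
    Literature.AlgebraicGeometry.Frobenioids.ArchFrd.Thm36vi_CA π (LambdaCompletion.self π)
      (LambdaCompletion.self π) :=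
  thm36vi_CA_of π _ _ (thm36vi_C π) (thm36vi_C π)

end ArchFrd

end

end Literature.AlgebraicGeometry.Frobenioids
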